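import Literature.Analysis.UnboundedOperators.HeatKernelBoundedData
import HarnessLib

/-!
# Commutators of the derivative of the heat flow with a multiplication operator

Analysis/UnboundedOperators support file (all results proved; no definitions, no named facts).
It serves the discharge of the named fact `Literature.Analysis.FluidPDE.BDSV.commutatorCZBound`
(`FluidPDE/OnsagerBDSVPotentialTheory`; Buckmaster–De Lellis–Székelyhidi–Vicol 2019, App. D,
Prop. D.1, after Constantin 2015, Lemma 1: `‖[∂ᵢ∂ⱼΔ⁻¹, b·∇]f‖_α ≲ ‖b‖_{1+α}‖f‖_α`), which is
carried out through the heat semigroup in the style of the tree's proof of App. C, Prop. C.1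
(`FluidPDE/TorusHeatHolder`, `FluidPDE/OnsagerBDSVPotentialTheoryProofs`), and continues
`UnboundedOperators/HeatKernelBoundedData` (caloric extension `e^{tΔ} g = heatExtension g t` of
bounded continuous data on a finite-dimensional real inner product space `E`).

The elementary operator here is `P_v^t G = ∂ᵥ(e^{tΔ} G)`, i.e. `x ↦ fderiv ℝ (heatExtension G t) x v`,
with kernel `∂ᵥG_t(x - y)`; its commutator with the multiplication by a scalar function `m`,
`[P_v^t, m] G (x) = ∂ᵥe^{tΔ}(m G)(x) - m(x) ∂ᵥe^{tΔ}G(x) = ∫ ∂ᵥG_t(x - y) (m(y) - m(x)) G(y) dy`,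
absorbs one derivative: it is bounded by `κ₁ Lip(m) ‖G‖_∞ ‖v‖` uniformly in `t` (the moment
`∫ ‖∇G_t(z)‖ ‖z‖ dz` is scale invariant), and, for `β`-Hölder `G`, it equals
`(∂ᵥe^{tΔ}m)(x) • G(x)` up to a remainder `≤ κ₂ t^{β/2} Lip(m) [G]_β ‖v‖` (the moment
`∫ ‖∇G_t(z)‖ ‖z‖^{1+β} dz ≲ t^{β/2}`).

## Main results

* `norm_mul_heatKernel_le`: `‖y‖ G_t(y) ≤ 2·2^{n/2} t^{1/2} G_{2t}(y)`;
  `integral_norm_fderiv_heatKernel_mul_norm_mul_rpow_le`: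
  `∫ ‖∇G_t(y)‖ ‖y‖ ‖y‖^β dy ≤ κ₂ t^{β/2}` for `0 ≤ β ≤ 1`.
* `fderiv_heatExtension_apply_eq_integral_of_bound`: the kernel form
  `∂ᵥ(e^{tΔ}G)(x) = ∫ ∂ᵥG_t(x - y) • G(y) dy` for bounded continuous `G`.
* `heatCommutator_eq_integral`, `norm_heatCommutator_le`: the commutator `[P_v^t, m] G` as an
  integral and its uniform bound; `norm_heatCommutator_sub_smul_le`: the refined splitting
  `[P_v^t, m] G = (∂ᵥe^{tΔ}m) • G + O(t^{β/2})`.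
* `norm_heatExtension_sub_heatExtension_le_of_holder`: `e^{tΔ}` preserves Hölder bounds.

## References

* T. Buckmaster, C. De Lellis, L. Székelyhidi Jr., V. Vicol, *Onsager's conjecture for admissible
  weak solutions*, CPAM 72 (2019) = arXiv:1701.08678, App. D, Prop. D.1 (consumer).
* P. Constantin, *Lagrangian–Eulerian methods for uniqueness in hydrodynamic systems*, Adv. Math.
  278 (2015) 67–102, Lemma 1.
* A. Lunardi, *Analytic Semigroups and Optimal Regularity in Parabolic Problems* (1995), §3.1
  (Hölder estimates via the heat semigroup).
-/

noncomputable section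

open MeasureTheory Set Filter Topology InnerProductSpace
open scoped Real ENNReal NNReal

namespace Literature.Analysis.UnboundedOperators

/-! ### Two more kernel moments -/

section Kernel

variable {E : Type*} [NormedAddCommGroup E] [InnerProductSpace ℝ E] [FiniteDimensional ℝ E]
  [MeasurableSpace E] [BorelSpace E]

omit [FiniteDimensional ℝ E] [MeasurableSpace E] [BorelSpace E] in
/-- `‖y‖ G_t(y) ≤ 2·2^{n/2} t^{1/2} G_{2t}(y)`: `‖y‖ G_t(y) = 2t ‖∇G_t(y)‖` and the Gaussian bound
`‖∇G_t(y)‖ ≤ 2^{n/2} t^{-1/2} G_{2t}(y)`. [folklore] -/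
theorem norm_mul_heatKernel_le {t : ℝ} (ht : 0 < t) (y : E) :
    ‖y‖ * heatKernel t y ≤
      2 * (2 : ℝ) ^ ((Module.finrank ℝ E : ℝ) / 2) * t ^ (1 / 2 : ℝ) * heatKernel (2 * t) y := by
  have h1 : ‖y‖ * heatKernel t y = (2 * t) * ‖fderiv ℝ (heatKernel t) y‖ := by
    rw [norm_fderiv_heatKernel ht]
    field_simp
  rw [h1]
  have h2 := norm_fderiv_heatKernel_le_heatKernel_two_mul ht y
  have ht' : t * t ^ (-(1 / 2 : ℝ)) = t ^ (1 / 2 : ℝ) := by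
    rw [show t * t ^ (-(1 / 2 : ℝ)) = t ^ (1 : ℝ) * t ^ (-(1 / 2 : ℝ)) by rw [Real.rpow_one],
      ← Real.rpow_add ht]
    norm_num
  calc (2 * t) * ‖fderiv ℝ (heatKernel t) y‖
      ≤ (2 * t) * ((2 : ℝ) ^ ((Module.finrank ℝ E : ℝ) / 2) * t ^ (-(1 / 2 : ℝ)) * heatKernel (2 * t) y) :=
        mul_le_mul_of_nonneg_left h2 (by positivity)
    _ = 2 * (2 : ℝ) ^ ((Module.finrank ℝ E : ℝ) / 2) * (t * t ^ (-(1 / 2 : ℝ))) * heatKernel (2 * t) y := by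
        ring
    _ = _ := by rw [ht']

/-- `y ↦ G_t(y) ‖y‖^β` is integrable for `0 ≤ β ≤ 1` (`‖y‖^β ≤ 1 + ‖y‖`). [folklore] -/
theorem integrable_heatKernel_mul_norm_rpow {t : ℝ} (ht : 0 < t) {β : ℝ} (hβ0 : 0 ≤ β) (hβ1 : β ≤ 1) :
    Integrable (fun y : E => heatKernel t y * ‖y‖ ^ β) := by
  have hK := integrable_heatKernel_holds (E := E) ht
  have hdom : Integrable (fun y : E => heatKernel t y * 1 + 1 * (heatKernel t y * ‖y‖)) :=
    (hK.mul_const _).add ((integrable_heatKernel_mul_norm ht).const_mul _)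
  have hmeas : AEStronglyMeasurable (fun y : E => heatKernel t y * ‖y‖ ^ β) volume :=
    ((continuous_heatKernel t).mul (continuous_norm.rpow_const fun _ => Or.inr hβ0)).aestronglyMeasurable
  refine hdom.mono' hmeas (Eventually.of_forall fun y => ?_)
  rw [Real.norm_of_nonneg (mul_nonneg (heatKernel_pos ht y).le (Real.rpow_nonneg (norm_nonneg _) _))]
  have h := rpow_le_rpow_add_rpow_sub_one_mul (norm_nonneg y) one_pos hβ0 hβ1
  simp only [Real.one_rpow, one_mul] at h
  have hG := (heatKernel_pos ht y).le
  calc heatKernel t y * ‖y‖ ^ β ≤ heatKernel t y * (1 + ‖y‖) := mul_le_mul_of_nonneg_left h hG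
    _ = heatKernel t y * 1 + 1 * (heatKernel t y * ‖y‖) := by ring

/-- The scale-invariant product `t^{-1/2} (2t)^{1/2} = 2^{1/2}`. [folklore] -/
theorem rpow_neg_half_mul_rpow_half {t : ℝ} (ht : 0 < t) :
    t ^ (-(1 / 2 : ℝ)) * (2 * t) ^ (1 / 2 : ℝ) = (2 : ℝ) ^ (1 / 2 : ℝ) := by
  rw [Real.mul_rpow (by norm_num : (0 : ℝ) ≤ 2) ht.le, mul_left_comm, ← Real.rpow_add ht]
  norm_num

/-- **`(1+β)`-moment of the gradient of the heat kernel**: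
`∫ ‖∇G_t(y)‖ ‖y‖ ‖y‖^β dy ≤ 2^{3/2}·4^{n/2}(1 + 2·2^{n/2}) (4t)^{β/2}` for `0 ≤ β ≤ 1`, `0 < t`
(two Gaussian bounds and the `β`-moment of `G_{4t}`), i.e. `≲ t^{β/2}`. [folklore] -/
theorem integral_norm_fderiv_heatKernel_mul_norm_mul_rpow_le {t : ℝ} (ht : 0 < t) {β : ℝ}
    (hβ0 : 0 ≤ β) (hβ1 : β ≤ 1) :
    Integrable (fun y : E => ‖fderiv ℝ (heatKernel t) y‖ * ‖y‖ * ‖y‖ ^ β) ∧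
    ∫ y : E, ‖fderiv ℝ (heatKernel t) y‖ * ‖y‖ * ‖y‖ ^ β ≤
      (2 * (2 : ℝ) ^ (1 / 2 : ℝ) * ((2 : ℝ) ^ ((Module.finrank ℝ E : ℝ) / 2)) ^ 2 *
        (1 + 2 * (2 : ℝ) ^ ((Module.finrank ℝ E : ℝ) / 2))) * (4 * t) ^ (β / 2) := by
  set c : ℝ := (2 : ℝ) ^ ((Module.finrank ℝ E : ℝ) / 2) with hc
  have hc0 : 0 < c := Real.rpow_pos_of_pos two_pos _
  have h2t : 0 < 2 * t := by positivity
  have h4t : 0 < 4 * t := by positivity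
  -- pointwise majorant `A G_{4t}(y) ‖y‖^β`
  set A : ℝ := c * t ^ (-(1 / 2 : ℝ)) * (2 * c * (2 * t) ^ (1 / 2 : ℝ)) with hA
  have hA0 : 0 ≤ A := by positivity
  have hAeq : A = 2 * (2 : ℝ) ^ (1 / 2 : ℝ) * c ^ 2 := by
    rw [hA, show c * t ^ (-(1 / 2 : ℝ)) * (2 * c * (2 * t) ^ (1 / 2 : ℝ)) =
      2 * c ^ 2 * (t ^ (-(1 / 2 : ℝ)) * (2 * t) ^ (1 / 2 : ℝ)) by ring, rpow_neg_half_mul_rpow_half ht]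
    ring
  have hpt : ∀ y : E, ‖fderiv ℝ (heatKernel t) y‖ * ‖y‖ * ‖y‖ ^ β ≤
      A * (heatKernel (4 * t) y * ‖y‖ ^ β) := fun y => by
    have hyβ : 0 ≤ ‖y‖ ^ β := Real.rpow_nonneg (norm_nonneg _) _
    have h1 := norm_fderiv_heatKernel_le_heatKernel_two_mul ht y
    have h2 := norm_mul_heatKernel_le h2t y
    rw [show 2 * (2 * t) = 4 * t by ring] at h2
    calc ‖fderiv ℝ (heatKernel t) y‖ * ‖y‖ * ‖y‖ ^ β
        ≤ (c * t ^ (-(1 / 2 : ℝ)) * heatKernel (2 * t) y) * ‖y‖ * ‖y‖ ^ β := by gcongr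
      _ = c * t ^ (-(1 / 2 : ℝ)) * (‖y‖ * heatKernel (2 * t) y) * ‖y‖ ^ β := by ring
      _ ≤ c * t ^ (-(1 / 2 : ℝ)) * (2 * c * (2 * t) ^ (1 / 2 : ℝ) * heatKernel (4 * t) y) * ‖y‖ ^ β := by
          gcongr
      _ = A * (heatKernel (4 * t) y * ‖y‖ ^ β) := by rw [hA]; ring
  have hdom : Integrable (fun y : E => A * (heatKernel (4 * t) y * ‖y‖ ^ β)) :=
    (integrable_heatKernel_mul_norm_rpow h4t hβ0 hβ1).const_mul A
  have hmeas : AEStronglyMeasurable (fun y : E => ‖fderiv ℝ (heatKernel t) y‖ * ‖y‖ * ‖y‖ ^ β) volume :=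
    (((continuous_fderiv_heatKernel t).norm.mul continuous_norm).mul
      (continuous_norm.rpow_const fun _ => Or.inr hβ0)).aestronglyMeasurable
  have hnn : ∀ y : E, 0 ≤ ‖fderiv ℝ (heatKernel t) y‖ * ‖y‖ * ‖y‖ ^ β := fun y =>
    mul_nonneg (mul_nonneg (norm_nonneg _) (norm_nonneg _)) (Real.rpow_nonneg (norm_nonneg _) _)
  have hint : Integrable (fun y : E => ‖fderiv ℝ (heatKernel t) y‖ * ‖y‖ * ‖y‖ ^ β) :=
    hdom.mono' hmeas (Eventually.of_forall fun y => by
      rw [Real.norm_of_nonneg (hnn y)]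
      exact hpt y)
  refine ⟨hint, ?_⟩
  calc ∫ y : E, ‖fderiv ℝ (heatKernel t) y‖ * ‖y‖ * ‖y‖ ^ β
      ≤ ∫ y : E, A * (heatKernel (4 * t) y * ‖y‖ ^ β) := integral_mono hint hdom hpt
    _ = A * ∫ y : E, heatKernel (4 * t) y * ‖y‖ ^ β := integral_const_mul _ _
    _ ≤ A * ((1 + 2 * c) * (4 * t) ^ (β / 2)) :=
        mul_le_mul_of_nonneg_left (integral_heatKernel_mul_norm_rpow_le h4t hβ0 hβ1) hA0
    _ = _ := by rw [hAeq]; ring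

/-- The first moment of the gradient is scale invariant:
`∫ ‖∇G_t(y)‖ ‖y‖ dy ≤ 2^{1/2}·2^{n/2}(1 + 2·2^{n/2})`. [folklore] -/
theorem integral_norm_fderiv_heatKernel_mul_norm_le {t : ℝ} (ht : 0 < t) :
    Integrable (fun y : E => ‖fderiv ℝ (heatKernel t) y‖ * ‖y‖) ∧
    ∫ y : E, ‖fderiv ℝ (heatKernel t) y‖ * ‖y‖ ≤
      (2 : ℝ) ^ (1 / 2 : ℝ) * (2 : ℝ) ^ ((Module.finrank ℝ E : ℝ) / 2) *
        (1 + 2 * (2 : ℝ) ^ ((Module.finrank ℝ E : ℝ) / 2)) := by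
  obtain ⟨hint, hle⟩ := integral_norm_fderiv_heatKernel_mul_norm_mul_rpow_le (E := E) ht le_rfl zero_le_one
  have heq : (fun y : E => ‖fderiv ℝ (heatKernel t) y‖ * ‖y‖ * ‖y‖ ^ (0 : ℝ)) =
      fun y : E => ‖fderiv ℝ (heatKernel t) y‖ * ‖y‖ := by
    funext y; rw [Real.rpow_zero, mul_one]
  rw [heq] at hint hle
  refine ⟨hint, ?_⟩
  have h := integral_norm_fderiv_heatKernel_mul_norm_rpow_le (E := E) ht zero_le_one le_rfl
  simp only [Real.rpow_one] at h
  refine h.trans_eq ?_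
  rw [show (1 : ℝ) / 2 = 1 / 2 from rfl,
    show (2 : ℝ) ^ ((Module.finrank ℝ E : ℝ) / 2) * t ^ (-(1 / 2 : ℝ)) *
      ((1 + 2 * (2 : ℝ) ^ ((Module.finrank ℝ E : ℝ) / 2)) * (2 * t) ^ ((1 : ℝ) / 2)) =
      (t ^ (-(1 / 2 : ℝ)) * (2 * t) ^ (1 / 2 : ℝ)) * (2 : ℝ) ^ ((Module.finrank ℝ E : ℝ) / 2) *
        (1 + 2 * (2 : ℝ) ^ ((Module.finrank ℝ E : ℝ) / 2)) by ring,
    rpow_neg_half_mul_rpow_half ht]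

/-- `∫ ∂ᵥG_t(y) dy = 0` (the gradient has mean zero). [folklore] -/
theorem integral_fderiv_heatKernel_apply_eq_zero {t : ℝ} (ht : 0 < t) (v : E) :
    ∫ y, fderiv ℝ (heatKernel (E := E) t) y v = 0 := by
  have hIop : Integrable (fderiv ℝ (heatKernel t)) (volume : Measure E) :=
    (integrable_norm_iff (continuous_fderiv_heatKernel t).aestronglyMeasurable).1
      (integrable_norm_fderiv_heatKernel ht)
  rw [← ContinuousLinearMap.integral_apply hIop v, integral_fderiv_heatKernel_eq_zero]
  rfl

end Kernel

/-! ### The derivative of the heat flow as an integral operator on bounded continuous data -/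

section Operator

variable {E : Type*} [NormedAddCommGroup E] [InnerProductSpace ℝ E] [FiniteDimensional ℝ E]
  [MeasurableSpace E] [BorelSpace E]
variable {F : Type*} [NormedAddCommGroup F] [NormedSpace ℝ F] [CompleteSpace F]

omit [FiniteDimensional ℝ E] [MeasurableSpace E] [BorelSpace E] [CompleteSpace F] in
/-- The operator-valued integrand `y ↦ ∇G_t(x - y) ⊗ G(y)` is continuous for continuous `G`.
[folklore] -/
theorem continuous_fderiv_heatKernel_sub_smulRight {G : E → F} (hG : Continuous G) (t : ℝ) (x : E) :
    Continuous fun y => (fderiv ℝ (heatKernel t) (x - y)).smulRight (G y) :=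
  (ContinuousLinearMap.smulRightL ℝ E F).continuous₂.comp
    (((continuous_fderiv_heatKernel t).comp (continuous_const.sub continuous_id)).prodMk hG)

omit [CompleteSpace F] in
/-- The operator-valued integrand `y ↦ ∇G_t(x - y) ⊗ G(y)` is integrable for bounded continuous
`G` and `0 < t`. [folklore] -/
theorem integrable_fderiv_heatKernel_sub_smulRight {G : E → F} (hG : Continuous G) {B : ℝ}
    (hB : ∀ z, ‖G z‖ ≤ B) {t : ℝ} (ht : 0 < t) (x : E) :
    Integrable (fun y => (fderiv ℝ (heatKernel t) (x - y)).smulRight (G y)) := by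
  refine (((integrable_norm_fderiv_heatKernel ht).comp_sub_left x).mul_const B).mono'
    (continuous_fderiv_heatKernel_sub_smulRight hG t x).aestronglyMeasurable
    (Eventually.of_forall fun y => ?_)
  rw [ContinuousLinearMap.norm_smulRight_apply]
  exact mul_le_mul_of_nonneg_left (hB _) (norm_nonneg _)

omit [CompleteSpace F] in
/-- The scalar integrand `y ↦ ∂ᵥG_t(x - y) • G(y)` is integrable for bounded continuous `G` and
`0 < t`. [folklore] -/
theorem integrable_fderiv_heatKernel_sub_apply_smul {G : E → F} (hG : Continuous G) {B : ℝ}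
    (hB : ∀ z, ‖G z‖ ≤ B) {t : ℝ} (ht : 0 < t) (x v : E) :
    Integrable (fun y => (fderiv ℝ (heatKernel t) (x - y) v) • G y) := by
  refine ((((integrable_norm_fderiv_heatKernel ht).comp_sub_left x).mul_const (‖v‖ * B))).mono'
    ((((continuous_fderiv_heatKernel t).comp (continuous_const.sub continuous_id)).clm_apply
      continuous_const).smul hG).aestronglyMeasurable
    (Eventually.of_forall fun y => ?_)
  rw [norm_smul]
  calc ‖fderiv ℝ (heatKernel t) (x - y) v‖ * ‖G y‖
      ≤ (‖fderiv ℝ (heatKernel t) (x - y)‖ * ‖v‖) * B :=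
        mul_le_mul (ContinuousLinearMap.le_opNorm _ _) (hB y) (norm_nonneg _)
          (mul_nonneg (norm_nonneg _) (norm_nonneg _))
    _ = ‖fderiv ℝ (heatKernel t) (x - y)‖ * (‖v‖ * B) := by ring

/-- **Kernel form of `∂ᵥ e^{tΔ}` on bounded continuous data**:
`∂ᵥ(e^{tΔ} G)(x) = ∫ ∂ᵥG_t(x - y) • G(y) dy`. [folklore] -/
theorem fderiv_heatExtension_apply_eq_integral_of_bound {G : E → F} (hG : Continuous G) {B : ℝ}
    (hB : ∀ z, ‖G z‖ ≤ B) {t : ℝ} (ht : 0 < t) (x v : E) :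
    fderiv ℝ (heatExtension G t) x v = ∫ y, (fderiv ℝ (heatKernel t) (x - y) v) • G y := by
  rw [fderiv_heatExtension_eq (memLp_top_of_continuous_of_bound hG hB) le_top ht]
  dsimp only
  rw [ContinuousLinearMap.integral_apply (integrable_fderiv_heatKernel_sub_smulRight hG hB ht x) v]
  rfl

/-- `e^{tΔ} G` of bounded continuous data is smooth, hence `x ↦ ∂ᵥ e^{tΔ} G (x)` is continuous.
[folklore] -/
theorem continuous_fderiv_heatExtension_apply_of_bound {G : E → F} (hG : Continuous G) {B : ℝ}
    (hB : ∀ z, ‖G z‖ ≤ B) {t : ℝ} (ht : 0 < t) (v : E) :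
    Continuous fun x => fderiv ℝ (heatExtension G t) x v :=
  ((contDiff_heatExtension_of_bound hG hB ht (m := 1)).continuous_fderiv one_ne_zero).clm_apply
    continuous_const

/-! ### The commutator with a multiplication operator -/

/-- **Kernel form of the commutator** `[∂ᵥe^{tΔ}, m] G (x) = ∂ᵥe^{tΔ}(m G)(x) - m(x) • ∂ᵥe^{tΔ}G(x)
= ∫ (∂ᵥG_t(x - y) (m(y) - m(x))) • G(y) dy` for bounded continuous `m : E → ℝ`, `G : E → F`.
[folklore] -/
theorem heatCommutator_eq_integral {m : E → ℝ} (hm : Continuous m) {Cm : ℝ} (hCm : ∀ z, ‖m z‖ ≤ Cm)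
    {G : E → F} (hG : Continuous G) {B : ℝ} (hB : ∀ z, ‖G z‖ ≤ B) {t : ℝ} (ht : 0 < t) (x v : E) :
    fderiv ℝ (heatExtension (fun z => m z • G z) t) x v - m x • fderiv ℝ (heatExtension G t) x v =
      ∫ y, (fderiv ℝ (heatKernel t) (x - y) v * (m y - m x)) • G y := by
  have hB0 : 0 ≤ B := (norm_nonneg _).trans (hB x)
  have hmG : Continuous fun z => m z • G z := hm.smul hG
  have hmGb : ∀ z, ‖m z • G z‖ ≤ Cm * B := fun z => by
    rw [norm_smul]
    exact mul_le_mul (hCm z) (hB z) (norm_nonneg _) ((norm_nonneg _).trans (hCm z))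
  rw [fderiv_heatExtension_apply_eq_integral_of_bound hmG hmGb ht x v,
    fderiv_heatExtension_apply_eq_integral_of_bound hG hB ht x v, ← integral_smul,
    ← integral_sub]
  · refine integral_congr_ae (Eventually.of_forall fun y => ?_)
    simp only [smul_smul]
    rw [← sub_smul]
    congr 1
    ring
  · refine (integrable_fderiv_heatKernel_sub_apply_smul hmG hmGb ht x v).congr
      (Eventually.of_forall fun y => ?_)
    simp only [smul_smul]
  · exact (integrable_fderiv_heatKernel_sub_apply_smul hG hB ht x v).smul (m x)

omit [CompleteSpace F] in
/-- Integrability of the commutator integrand against a majorant `‖∇G_t(x-y)‖ ‖x - y‖ K`.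
[folklore] -/
theorem integrable_heatCommutator_integrand {m : E → ℝ} (hm : Continuous m) {L : ℝ}
    (hL : ∀ y z, ‖m y - m z‖ ≤ L * ‖y - z‖) {G : E → F} (hG : Continuous G) {B : ℝ}
    (hB : ∀ z, ‖G z‖ ≤ B) {t : ℝ} (ht : 0 < t) (x v : E) :
    Integrable (fun y => (fderiv ℝ (heatKernel t) (x - y) v * (m y - m x)) • G y) := by
  have hB0 : 0 ≤ B := (norm_nonneg _).trans (hB x)
  have hmaj : Integrable (fun y => ‖fderiv ℝ (heatKernel t) (x - y)‖ * ‖x - y‖ * (‖v‖ * L * B)) := by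
    have h := ((integral_norm_fderiv_heatKernel_mul_norm_le (E := E) ht).1.comp_sub_left x).mul_const
      (‖v‖ * L * B)
    exact h
  refine hmaj.mono' ?_ (Eventually.of_forall fun y => ?_)
  · exact (((((continuous_fderiv_heatKernel t).comp (continuous_const.sub continuous_id)).clm_apply
      continuous_const).mul (hm.sub continuous_const)).smul hG).aestronglyMeasurable
  · rw [norm_smul, norm_mul]
    have h1 : ‖fderiv ℝ (heatKernel t) (x - y) v‖ ≤ ‖fderiv ℝ (heatKernel t) (x - y)‖ * ‖v‖ :=
      ContinuousLinearMap.le_opNorm _ _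
    have h2 : ‖m y - m x‖ ≤ L * ‖x - y‖ := by rw [norm_sub_rev (m y), ]; exact (hL x y)
    have hL0 : 0 ≤ L * ‖x - y‖ := (norm_nonneg _).trans h2
    calc ‖fderiv ℝ (heatKernel t) (x - y) v‖ * ‖m y - m x‖ * ‖G y‖
        ≤ (‖fderiv ℝ (heatKernel t) (x - y)‖ * ‖v‖) * (L * ‖x - y‖) * B := by
          gcongr
          exact hB y
      _ = ‖fderiv ℝ (heatKernel t) (x - y)‖ * ‖x - y‖ * (‖v‖ * L * B) := by ring

/-- **The commutator absorbs one derivative**: for `m` Lipschitz with constant `L` (and bounded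
continuous) and `G` bounded by `B`,
`‖∂ᵥe^{tΔ}(m G)(x) - m(x) • ∂ᵥe^{tΔ}G(x)‖ ≤ 2^{1/2}·2^{n/2}(1 + 2·2^{n/2}) L B ‖v‖`, uniformly in
`t > 0` (the first moment `∫ ‖∇G_t(z)‖ ‖z‖ dz` is scale invariant). This is the mechanism of
Constantin's commutator lemma (Constantin 2015, Lemma 1) at the level of the heat kernel. [folklore] -/
theorem norm_heatCommutator_le {m : E → ℝ} (hm : Continuous m) {Cm : ℝ} (hCm : ∀ z, ‖m z‖ ≤ Cm)
    {L : ℝ} (hL0 : 0 ≤ L) (hL : ∀ y z, ‖m y - m z‖ ≤ L * ‖y - z‖) {G : E → F} (hG : Continuous G)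
    {B : ℝ} (hB : ∀ z, ‖G z‖ ≤ B) {t : ℝ} (ht : 0 < t) (x v : E) :
    ‖fderiv ℝ (heatExtension (fun z => m z • G z) t) x v - m x • fderiv ℝ (heatExtension G t) x v‖ ≤
      (2 : ℝ) ^ (1 / 2 : ℝ) * (2 : ℝ) ^ ((Module.finrank ℝ E : ℝ) / 2) *
        (1 + 2 * (2 : ℝ) ^ ((Module.finrank ℝ E : ℝ) / 2)) * L * B * ‖v‖ := by
  have hB0 : 0 ≤ B := (norm_nonneg _).trans (hB x)
  rw [heatCommutator_eq_integral hm hCm hG hB ht x v]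
  obtain ⟨hint, hle⟩ := integral_norm_fderiv_heatKernel_mul_norm_le (E := E) ht
  have hmaj : Integrable (fun y => ‖fderiv ℝ (heatKernel t) (x - y)‖ * ‖x - y‖ * (‖v‖ * L * B)) :=
    (hint.comp_sub_left x).mul_const (‖v‖ * L * B)
  calc ‖∫ y, (fderiv ℝ (heatKernel t) (x - y) v * (m y - m x)) • G y‖
      ≤ ∫ y, ‖fderiv ℝ (heatKernel t) (x - y)‖ * ‖x - y‖ * (‖v‖ * L * B) := by
        refine norm_integral_le_of_norm_le hmaj (Eventually.of_forall fun y => ?_)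
        rw [norm_smul, norm_mul]
        have h1 : ‖fderiv ℝ (heatKernel t) (x - y) v‖ ≤ ‖fderiv ℝ (heatKernel t) (x - y)‖ * ‖v‖ :=
          ContinuousLinearMap.le_opNorm _ _
        have h2 : ‖m y - m x‖ ≤ L * ‖x - y‖ := by rw [norm_sub_rev (m y)]; exact hL x y
        calc ‖fderiv ℝ (heatKernel t) (x - y) v‖ * ‖m y - m x‖ * ‖G y‖
            ≤ (‖fderiv ℝ (heatKernel t) (x - y)‖ * ‖v‖) * (L * ‖x - y‖) * B := by
              gcongr
              exact hB y
          _ = ‖fderiv ℝ (heatKernel t) (x - y)‖ * ‖x - y‖ * (‖v‖ * L * B) := by ring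
    _ = (∫ y, ‖fderiv ℝ (heatKernel t) y‖ * ‖y‖) * (‖v‖ * L * B) := by
        rw [integral_mul_const]
        congr 1
        exact integral_sub_left_eq_self (fun y => ‖fderiv ℝ (heatKernel t) y‖ * ‖y‖) volume x
    _ ≤ ((2 : ℝ) ^ (1 / 2 : ℝ) * (2 : ℝ) ^ ((Module.finrank ℝ E : ℝ) / 2) *
        (1 + 2 * (2 : ℝ) ^ ((Module.finrank ℝ E : ℝ) / 2))) * (‖v‖ * L * B) :=
        mul_le_mul_of_nonneg_right hle (by positivity)
    _ = _ := by ring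

/-- **Refined splitting of the commutator.** With `∂ᵥe^{tΔ}m (x) = ∫ ∂ᵥG_t(x - y) m(y) dy` and
`∫ ∂ᵥG_t = 0`,
`[∂ᵥe^{tΔ}, m] G (x) - (∂ᵥe^{tΔ}m)(x) • G(x) = ∫ (∂ᵥG_t(x - y)(m(y) - m(x))) • (G(y) - G(x)) dy`,
so that for `m` Lipschitz (`L`) and `G` `β`-Hölder (`A`, `0 ≤ β ≤ 1`) the difference is bounded by
`κ₂ (4t)^{β/2} L A ‖v‖`, `κ₂ = 2^{3/2} 4^{n/2} (1 + 2·2^{n/2})`: the commutator gains `t^{β/2}`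
up to the explicit term `(∂ᵥe^{tΔ}m) • G`. [folklore] -/
theorem norm_heatCommutator_sub_smul_le {m : E → ℝ} (hm : Continuous m) {Cm : ℝ}
    (hCm : ∀ z, ‖m z‖ ≤ Cm) {L : ℝ} (hL0 : 0 ≤ L) (hL : ∀ y z, ‖m y - m z‖ ≤ L * ‖y - z‖)
    {G : E → F} (hG : Continuous G) {B : ℝ} (hB : ∀ z, ‖G z‖ ≤ B) {A β : ℝ} (hA : 0 ≤ A)
    (hβ0 : 0 ≤ β) (hβ1 : β ≤ 1) (hH : ∀ y z, ‖G y - G z‖ ≤ A * ‖y - z‖ ^ β) {t : ℝ} (ht : 0 < t)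
    (x v : E) :
    ‖fderiv ℝ (heatExtension (fun z => m z • G z) t) x v - m x • fderiv ℝ (heatExtension G t) x v -
        fderiv ℝ (heatExtension m t) x v • G x‖ ≤
      (2 * (2 : ℝ) ^ (1 / 2 : ℝ) * ((2 : ℝ) ^ ((Module.finrank ℝ E : ℝ) / 2)) ^ 2 *
        (1 + 2 * (2 : ℝ) ^ ((Module.finrank ℝ E : ℝ) / 2))) * (4 * t) ^ (β / 2) * L * A * ‖v‖ := by
  set κ : ℝ := 2 * (2 : ℝ) ^ (1 / 2 : ℝ) * ((2 : ℝ) ^ ((Module.finrank ℝ E : ℝ) / 2)) ^ 2 *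
    (1 + 2 * (2 : ℝ) ^ ((Module.finrank ℝ E : ℝ) / 2)) with hκ
  set k : E → ℝ := fun y => fderiv ℝ (heatKernel t) (x - y) v with hk
  -- the scalar operator on `m`
  have hPm : fderiv ℝ (heatExtension m t) x v = ∫ y, k y * (m y - m x) := by
    rw [fderiv_heatExtension_apply_eq_integral_of_bound hm hCm ht x v]
    have h1 : Integrable (fun y => k y • m y) := integrable_fderiv_heatKernel_sub_apply_smul hm hCm ht x v
    have h2 : Integrable (fun y => k y * m x) := by
      have := ((integrable_fderiv_heatKernel_apply ht v).comp_sub_left x).mul_const (m x)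
      exact this
    have hzero : ∫ y, k y * m x = 0 := by
      rw [integral_mul_const]
      have := integral_sub_left_eq_self (fun y => fderiv ℝ (heatKernel t) y v) volume x
      rw [hk]
      simp only at this ⊢
      rw [this, integral_fderiv_heatKernel_apply_eq_zero ht v, zero_mul]
    simp_rw [mul_sub]
    rw [integral_sub (by simpa [smul_eq_mul] using h1) h2, hzero, sub_zero]
    rfl
  -- the commutator and the subtracted term as integrals
  have hcomm := heatCommutator_eq_integral hm hCm hG hB ht x v
  have hI1 : Integrable (fun y => (k y * (m y - m x)) • G y) :=
    integrable_heatCommutator_integrand hm hL hG hB ht x v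
  have hI2 : Integrable (fun y => (k y * (m y - m x)) • G x) := by
    have h1 : Integrable (fun y => k y * (m y - m x)) := by
      have := integrable_heatCommutator_integrand (F := ℝ) hm hL continuous_const
        (fun _ => (norm_one (α := ℝ)).le) ht x v
      simpa [smul_eq_mul] using this
    exact h1.smul_const (G x)
  have hdiff : fderiv ℝ (heatExtension (fun z => m z • G z) t) x v - m x • fderiv ℝ (heatExtension G t) x v -
      fderiv ℝ (heatExtension m t) x v • G x = ∫ y, (k y * (m y - m x)) • (G y - G x) := by
    rw [hcomm, hPm, ← integral_smul_const, ← integral_sub hI1 hI2]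
    refine integral_congr_ae (Eventually.of_forall fun y => ?_)
    simp only [smul_sub]
  rw [hdiff]
  -- the bound
  obtain ⟨hint, hle⟩ := integral_norm_fderiv_heatKernel_mul_norm_mul_rpow_le (E := E) ht hβ0 hβ1
  have hmaj : Integrable (fun y => ‖fderiv ℝ (heatKernel t) (x - y)‖ * ‖x - y‖ * ‖x - y‖ ^ β *
      (‖v‖ * L * A)) := (hint.comp_sub_left x).mul_const (‖v‖ * L * A)
  calc ‖∫ y, (k y * (m y - m x)) • (G y - G x)‖
      ≤ ∫ y, ‖fderiv ℝ (heatKernel t) (x - y)‖ * ‖x - y‖ * ‖x - y‖ ^ β * (‖v‖ * L * A) := by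
        refine norm_integral_le_of_norm_le hmaj (Eventually.of_forall fun y => ?_)
        rw [norm_smul, norm_mul]
        have h1 : ‖k y‖ ≤ ‖fderiv ℝ (heatKernel t) (x - y)‖ * ‖v‖ := ContinuousLinearMap.le_opNorm _ _
        have h2 : ‖m y - m x‖ ≤ L * ‖x - y‖ := by rw [norm_sub_rev (m y)]; exact hL x y
        have h3 : ‖G y - G x‖ ≤ A * ‖x - y‖ ^ β := by rw [norm_sub_rev (G y)]; exact hH x y
        calc ‖k y‖ * ‖m y - m x‖ * ‖G y - G x‖
            ≤ (‖fderiv ℝ (heatKernel t) (x - y)‖ * ‖v‖) * (L * ‖x - y‖) * (A * ‖x - y‖ ^ β) := by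
              gcongr
          _ = ‖fderiv ℝ (heatKernel t) (x - y)‖ * ‖x - y‖ * ‖x - y‖ ^ β * (‖v‖ * L * A) := by ring
    _ = (∫ y, ‖fderiv ℝ (heatKernel t) y‖ * ‖y‖ * ‖y‖ ^ β) * (‖v‖ * L * A) := by
        rw [integral_mul_const]
        congr 1
        exact integral_sub_left_eq_self
          (fun y => ‖fderiv ℝ (heatKernel t) y‖ * ‖y‖ * ‖y‖ ^ β) volume x
    _ ≤ (κ * (4 * t) ^ (β / 2)) * (‖v‖ * L * A) := mul_le_mul_of_nonneg_right hle (by positivity)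
    _ = _ := by ring

/-! ### Hölder bounds propagate under the heat flow -/

omit [CompleteSpace F] in
/-- **`e^{tΔ}` preserves Hölder bounds**: if `‖g y - g z‖ ≤ A ‖y - z‖^β` for all `y, z` (and `g` is
bounded continuous), then `‖e^{tΔ}g (x) - e^{tΔ}g (y)‖ ≤ A ‖x - y‖^β` (translation invariance
and `∫ G_t = 1`). [folklore] -/
theorem norm_heatExtension_sub_heatExtension_le_of_holder {g : E → F} (hg : Continuous g) {C : ℝ}
    (hC : ∀ z, ‖g z‖ ≤ C) {A β : ℝ} (hH : ∀ y z, ‖g y - g z‖ ≤ A * ‖y - z‖ ^ β) {t : ℝ}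
    (ht : 0 < t) (x y : E) :
    ‖heatExtension g t x - heatExtension g t y‖ ≤ A * ‖x - y‖ ^ β := by
  rw [heatExtension_apply, heatExtension_apply, ← integral_sub (integrable_heatKernel_smul_of_bound hg hC ht x)
    (integrable_heatKernel_smul_of_bound hg hC ht y)]
  have hmaj : Integrable (fun z : E => heatKernel t z * (A * ‖x - y‖ ^ β)) :=
    (integrable_heatKernel_holds ht).mul_const _
  calc ‖∫ z, (heatKernel t z • g (x - z) - heatKernel t z • g (y - z))‖
      ≤ ∫ z, heatKernel t z * (A * ‖x - y‖ ^ β) := by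
        refine norm_integral_le_of_norm_le hmaj (Eventually.of_forall fun z => ?_)
        rw [← smul_sub, norm_smul, Real.norm_of_nonneg (heatKernel_pos ht z).le]
        refine mul_le_mul_of_nonneg_left ?_ (heatKernel_pos ht z).le
        have h := hH (x - z) (y - z)
        rwa [show x - z - (y - z) = x - y by abel] at h
    _ = A * ‖x - y‖ ^ β := by
        rw [integral_mul_const, integral_heatKernel_eq_one_holds ht, one_mul]

/-- **Sup bound for `∂ᵥe^{tΔ}m`** in terms of the derivative of the datum: if `m ∈ C¹` is bounded
with `‖Dm‖ ≤ L`, then `‖∂ᵥ e^{tΔ} m (x)‖ ≤ L ‖v‖` (`∂ᵥe^{tΔ}m = e^{tΔ}(∂ᵥm)` and the maximum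
principle). [folklore] -/
theorem norm_fderiv_heatExtension_apply_le_of_fderiv_le {m : E → F} (hm : ContDiff ℝ 1 m) {Cm : ℝ}
    (hCm : ∀ z, ‖m z‖ ≤ Cm) {L : ℝ} (hL : ∀ z, ‖fderiv ℝ m z‖ ≤ L) {t : ℝ} (ht : 0 < t) (x v : E) :
    ‖fderiv ℝ (heatExtension m t) x v‖ ≤ L * ‖v‖ := by
  have h1 : ∀ z, ‖fderiv ℝ m z v‖ ≤ L * ‖v‖ := fun z =>
    (ContinuousLinearMap.le_opNorm _ _).trans (mul_le_mul_of_nonneg_right (hL z) (norm_nonneg _))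
  rw [fderiv_heatExtension_apply_of_bounded hm hCm h1 ht x]
  exact norm_heatExtension_le h1 ht x

/-- **Hölder bound for `∂ᵥe^{tΔ}m`** in terms of the Hölder constant of the derivative of the datum:
if `m ∈ C¹` is bounded with `‖Dm‖ ≤ L` and `‖Dm(y) - Dm(z)‖ ≤ L' ‖y - z‖^β`, then
`‖∂ᵥe^{tΔ}m (x) - ∂ᵥe^{tΔ}m (y)‖ ≤ L' ‖v‖ ‖x - y‖^β`. [folklore] -/
theorem norm_fderiv_heatExtension_apply_sub_le_of_fderiv_holder {m : E → F} (hm : ContDiff ℝ 1 m)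
    {Cm : ℝ} (hCm : ∀ z, ‖m z‖ ≤ Cm) {L : ℝ} (hL : ∀ z, ‖fderiv ℝ m z‖ ≤ L) {L' β : ℝ}
    (hL' : ∀ y z, ‖fderiv ℝ m y - fderiv ℝ m z‖ ≤ L' * ‖y - z‖ ^ β) {t : ℝ} (ht : 0 < t)
    (v x y : E) :
    ‖fderiv ℝ (heatExtension m t) x v - fderiv ℝ (heatExtension m t) y v‖ ≤ L' * ‖v‖ * ‖x - y‖ ^ β := by
  have h1 : ∀ z, ‖fderiv ℝ m z v‖ ≤ L * ‖v‖ := fun z =>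
    (ContinuousLinearMap.le_opNorm _ _).trans (mul_le_mul_of_nonneg_right (hL z) (norm_nonneg _))
  have hcont : Continuous fun z => fderiv ℝ m z v :=
    (hm.continuous_fderiv one_ne_zero).clm_apply continuous_const
  have hH : ∀ y z, ‖fderiv ℝ m y v - fderiv ℝ m z v‖ ≤ L' * ‖v‖ * ‖y - z‖ ^ β := fun y z => by
    calc ‖fderiv ℝ m y v - fderiv ℝ m z v‖ = ‖(fderiv ℝ m y - fderiv ℝ m z) v‖ := rfl
      _ ≤ ‖fderiv ℝ m y - fderiv ℝ m z‖ * ‖v‖ := ContinuousLinearMap.le_opNorm _ _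
      _ ≤ L' * ‖y - z‖ ^ β * ‖v‖ := mul_le_mul_of_nonneg_right (hL' y z) (norm_nonneg _)
      _ = L' * ‖v‖ * ‖y - z‖ ^ β := by ring
  rw [fderiv_heatExtension_apply_of_bounded hm hCm h1 ht x, fderiv_heatExtension_apply_of_bounded hm hCm h1 ht y]
  exact norm_heatExtension_sub_heatExtension_le_of_holder hcont h1 hH ht x y

/-! ### Linearity of `∂ᵥe^{tΔ}` on bounded continuous data -/

/-- `∂ᵥe^{tΔ}(G + H) = ∂ᵥe^{tΔ}G + ∂ᵥe^{tΔ}H` on bounded continuous data. [folklore] -/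
theorem fderiv_heatExtension_add_apply_of_bound {G H : E → F} (hG : Continuous G) (hH : Continuous H)
    {B B' : ℝ} (hB : ∀ z, ‖G z‖ ≤ B) (hB' : ∀ z, ‖H z‖ ≤ B') {t : ℝ} (ht : 0 < t) (x v : E) :
    fderiv ℝ (heatExtension (fun z => G z + H z) t) x v =
      fderiv ℝ (heatExtension G t) x v + fderiv ℝ (heatExtension H t) x v := by
  have heq : heatExtension (fun z => G z + H z) t = heatExtension G t + heatExtension H t :=
    funext fun y => heatExtension_add_of_bound hG hH hB hB' ht y
  rw [heq, fderiv_add ((contDiff_heatExtension_of_bound hG hB ht (m := 1)).differentiable one_ne_zero x)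
    ((contDiff_heatExtension_of_bound hH hB' ht (m := 1)).differentiable one_ne_zero x)]
  rfl

/-- `∂ᵥe^{tΔ}(G - H) = ∂ᵥe^{tΔ}G - ∂ᵥe^{tΔ}H` on bounded continuous data. [folklore] -/
theorem fderiv_heatExtension_sub_apply_of_bound {G H : E → F} (hG : Continuous G) (hH : Continuous H)
    {B B' : ℝ} (hB : ∀ z, ‖G z‖ ≤ B) (hB' : ∀ z, ‖H z‖ ≤ B') {t : ℝ} (ht : 0 < t) (x v : E) :
    fderiv ℝ (heatExtension (fun z => G z - H z) t) x v =
      fderiv ℝ (heatExtension G t) x v - fderiv ℝ (heatExtension H t) x v := by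
  have heq : heatExtension (fun z => G z - H z) t = heatExtension G t - heatExtension H t :=
    funext fun y => heatExtension_sub_of_bound hG hH hB hB' ht y
  rw [heq, fderiv_sub ((contDiff_heatExtension_of_bound hG hB ht (m := 1)).differentiable one_ne_zero x)
    ((contDiff_heatExtension_of_bound hH hB' ht (m := 1)).differentiable one_ne_zero x)]
  rfl

/-! ### One smoothing step on bounded continuous data -/

/-- Bounded data: `‖∂ᵥe^{aΔ}G (x)‖ ≤ 2^{n/2} a^{-1/2} B ‖v‖` for continuous `G` with `‖G‖ ≤ B`.
[cite: GigaGigaSaal2010, §1.1.3] -/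
theorem norm_fderiv_heatExtension_apply_le_of_continuous {G : E → F} (hG : Continuous G) {B : ℝ}
    (hB : ∀ z, ‖G z‖ ≤ B) {a : ℝ} (ha : 0 < a) (x v : E) :
    ‖fderiv ℝ (heatExtension G a) x v‖ ≤
      (2 : ℝ) ^ ((Module.finrank ℝ E : ℝ) / 2) * a ^ (-(1 / 2 : ℝ)) * B * ‖v‖ :=
  norm_fderiv_heatExtension_apply_le_of_bounded hG.aestronglyMeasurable hB ha x v

/-- Hölder data, single-power form: `‖∂ᵥe^{aΔ}G (x)‖ ≤ 2·2^{n/2}(1 + 2·2^{n/2}) a^{(β-1)/2} A ‖v‖`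
if `‖G y - G z‖ ≤ A ‖y - z‖^β` (`0 ≤ β ≤ 1`), since `(2a)^{β/2} ≤ 2 a^{β/2}`.
[cite: BuckmasterEtAl2018, §2.2 (standard mollification estimates)] -/
theorem norm_fderiv_heatExtension_apply_le_of_holder' {G : E → F} (hG : Continuous G) {B : ℝ}
    (hB : ∀ z, ‖G z‖ ≤ B) {A β : ℝ} (hA : 0 ≤ A) (hβ0 : 0 ≤ β) (hβ1 : β ≤ 1)
    (hH : ∀ y z, ‖G y - G z‖ ≤ A * ‖y - z‖ ^ β) {a : ℝ} (ha : 0 < a) (x v : E) :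
    ‖fderiv ℝ (heatExtension G a) x v‖ ≤
      2 * (2 : ℝ) ^ ((Module.finrank ℝ E : ℝ) / 2) * (1 + 2 * (2 : ℝ) ^ ((Module.finrank ℝ E : ℝ) / 2)) *
        a ^ ((β - 1) / 2) * A * ‖v‖ := by
  set c : ℝ := (2 : ℝ) ^ ((Module.finrank ℝ E : ℝ) / 2) with hc
  have h := norm_fderiv_heatExtension_apply_le_of_holder hG hB hA hβ0 hβ1 hH ha x v
  rw [← hc] at h
  refine h.trans ?_
  have h2a : (2 * a) ^ (β / 2) ≤ 2 * a ^ (β / 2) := by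
    rw [Real.mul_rpow (by norm_num : (0 : ℝ) ≤ 2) ha.le]
    refine mul_le_mul_of_nonneg_right ?_ (Real.rpow_nonneg ha.le _)
    calc (2 : ℝ) ^ (β / 2) ≤ (2 : ℝ) ^ (1 : ℝ) :=
          Real.rpow_le_rpow_of_exponent_le (by norm_num) (by linarith)
      _ = 2 := Real.rpow_one 2
  have hpow : a ^ (-(1 / 2 : ℝ)) * a ^ (β / 2) = a ^ ((β - 1) / 2) := by
    rw [← Real.rpow_add ha]; congr 1; ring
  calc c * a ^ (-(1 / 2 : ℝ)) * ((1 + 2 * c) * (2 * a) ^ (β / 2)) * A * ‖v‖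
      ≤ c * a ^ (-(1 / 2 : ℝ)) * ((1 + 2 * c) * (2 * a ^ (β / 2))) * A * ‖v‖ := by gcongr
    _ = 2 * c * (1 + 2 * c) * (a ^ (-(1 / 2 : ℝ)) * a ^ (β / 2)) * A * ‖v‖ := by ring
    _ = _ := by rw [hpow]

/-- Product of powers: `a^{-1/2} a^s = a^{s - 1/2}`. [folklore] -/
theorem rpow_neg_half_mul_rpow {a : ℝ} (ha : 0 < a) (s : ℝ) :
    a ^ (-(1 / 2 : ℝ)) * a ^ s = a ^ (s - 1 / 2) := by
  rw [← Real.rpow_add ha]; congr 1; ring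

/-- **Two smoothing steps on Hölder data**:
`‖∂ⱼe^{aΔ}(∂ₗe^{aΔ}F)(x)‖ ≤ 2^{n/2}·(2·2^{n/2}(1+2·2^{n/2})) a^{β/2-1} A ‖vⱼ‖ ‖vₗ‖`. [folklore] -/
theorem norm_fderiv_heatExtension₂_apply_le_of_holder {G : E → F} (hG : Continuous G) {B : ℝ}
    (hB : ∀ z, ‖G z‖ ≤ B) {A β : ℝ} (hA : 0 ≤ A) (hβ0 : 0 ≤ β) (hβ1 : β ≤ 1)
    (hH : ∀ y z, ‖G y - G z‖ ≤ A * ‖y - z‖ ^ β) {a : ℝ} (ha : 0 < a) (x vj vl : E) :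
    ‖fderiv ℝ (heatExtension (fun y => fderiv ℝ (heatExtension G a) y vl) a) x vj‖ ≤
      (2 : ℝ) ^ ((Module.finrank ℝ E : ℝ) / 2) *
        (2 * (2 : ℝ) ^ ((Module.finrank ℝ E : ℝ) / 2) * (1 + 2 * (2 : ℝ) ^ ((Module.finrank ℝ E : ℝ) / 2))) *
        a ^ (β / 2 - 1) * A * ‖vj‖ * ‖vl‖ := by
  set c : ℝ := (2 : ℝ) ^ ((Module.finrank ℝ E : ℝ) / 2) with hc
  set c₁ : ℝ := 2 * c * (1 + 2 * c) with hc₁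
  have hb₁ : ∀ y, ‖fderiv ℝ (heatExtension G a) y vl‖ ≤ c₁ * a ^ ((β - 1) / 2) * A * ‖vl‖ := fun y =>
    norm_fderiv_heatExtension_apply_le_of_holder' hG hB hA hβ0 hβ1 hH ha y vl
  have h := norm_fderiv_heatExtension_apply_le_of_continuous
    (continuous_fderiv_heatExtension_apply_of_bound hG hB ha vl) hb₁ ha x vj
  rw [← hc] at h
  refine h.trans_eq ?_
  have hpow : a ^ (-(1 / 2 : ℝ)) * a ^ ((β - 1) / 2) = a ^ (β / 2 - 1) := by
    rw [rpow_neg_half_mul_rpow ha]; congr 1; ring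
  calc c * a ^ (-(1 / 2 : ℝ)) * (c₁ * a ^ ((β - 1) / 2) * A * ‖vl‖) * ‖vj‖
      = c * c₁ * (a ^ (-(1 / 2 : ℝ)) * a ^ ((β - 1) / 2)) * A * ‖vj‖ * ‖vl‖ := by ring
    _ = _ := by rw [hpow]

/-- **Three smoothing steps on Hölder data**:
`‖∂ᵢe^{aΔ}∂ⱼe^{aΔ}∂ₗe^{aΔ}F (x)‖ ≤ (2^{n/2})²·(2·2^{n/2}(1+2·2^{n/2})) a^{(β-3)/2} A ‖vᵢ‖ ‖vⱼ‖ ‖vₗ‖`.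
[folklore] -/
theorem norm_fderiv_heatExtension₃_apply_le_of_holder {G : E → F} (hG : Continuous G) {B : ℝ}
    (hB : ∀ z, ‖G z‖ ≤ B) {A β : ℝ} (hA : 0 ≤ A) (hβ0 : 0 ≤ β) (hβ1 : β ≤ 1)
    (hH : ∀ y z, ‖G y - G z‖ ≤ A * ‖y - z‖ ^ β) {a : ℝ} (ha : 0 < a) (x vi vj vl : E) :
    ‖fderiv ℝ (heatExtension (fun y' => fderiv ℝ (heatExtension
        (fun y => fderiv ℝ (heatExtension G a) y vl) a) y' vj) a) x vi‖ ≤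
      ((2 : ℝ) ^ ((Module.finrank ℝ E : ℝ) / 2)) ^ 2 *
        (2 * (2 : ℝ) ^ ((Module.finrank ℝ E : ℝ) / 2) * (1 + 2 * (2 : ℝ) ^ ((Module.finrank ℝ E : ℝ) / 2))) *
        a ^ ((β - 3) / 2) * A * ‖vi‖ * ‖vj‖ * ‖vl‖ := by
  set c : ℝ := (2 : ℝ) ^ ((Module.finrank ℝ E : ℝ) / 2) with hc
  set c₁ : ℝ := 2 * c * (1 + 2 * c) with hc₁
  have hb₁ : ∀ y, ‖fderiv ℝ (heatExtension G a) y vl‖ ≤ c₁ * a ^ ((β - 1) / 2) * A * ‖vl‖ := fun y =>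
    norm_fderiv_heatExtension_apply_le_of_holder' hG hB hA hβ0 hβ1 hH ha y vl
  have hb₂ : ∀ y', ‖fderiv ℝ (heatExtension (fun y => fderiv ℝ (heatExtension G a) y vl) a) y' vj‖ ≤
      c * c₁ * a ^ (β / 2 - 1) * A * ‖vj‖ * ‖vl‖ := fun y' =>
    norm_fderiv_heatExtension₂_apply_le_of_holder hG hB hA hβ0 hβ1 hH ha y' vj vl
  have hcont₁ := continuous_fderiv_heatExtension_apply_of_bound hG hB ha vl
  have hcont₂ := continuous_fderiv_heatExtension_apply_of_bound hcont₁ hb₁ ha vj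
  have h := norm_fderiv_heatExtension_apply_le_of_continuous hcont₂ hb₂ ha x vi
  rw [← hc] at h
  refine h.trans_eq ?_
  have hpow : a ^ (-(1 / 2 : ℝ)) * a ^ (β / 2 - 1) = a ^ ((β - 3) / 2) := by
    rw [rpow_neg_half_mul_rpow ha]; congr 1; ring
  calc c * a ^ (-(1 / 2 : ℝ)) * (c * c₁ * a ^ (β / 2 - 1) * A * ‖vj‖ * ‖vl‖) * ‖vi‖
      = c ^ 2 * c₁ * (a ^ (-(1 / 2 : ℝ)) * a ^ (β / 2 - 1)) * A * ‖vi‖ * ‖vj‖ * ‖vl‖ := by ring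
    _ = _ := by rw [hpow]

/-! ### The commutator bounds of order two, three and four -/

omit [FiniteDimensional ℝ E] [MeasurableSpace E] [BorelSpace E] [CompleteSpace F] in
/-- A `C¹` function with `‖Dm‖ ≤ L` is `L`-Lipschitz. [folklore] -/
theorem norm_sub_le_of_norm_fderiv_le {m : E → F} (hm : ContDiff ℝ 1 m) {L : ℝ}
    (hL : ∀ z, ‖fderiv ℝ m z‖ ≤ L) (y z : E) : ‖m y - m z‖ ≤ L * ‖y - z‖ :=
  convex_univ.norm_image_sub_le_of_norm_fderiv_le
    (fun w _ => (hm.differentiable one_ne_zero w)) (fun w _ => hL w) (mem_univ z) (mem_univ y)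

/-- **The second-order commutator**: for `m ∈ C¹(E)` bounded with `‖Dm‖ ≤ L`,
`‖Dm(y) - Dm(z)‖ ≤ L' ‖y - z‖^β`, and `F` continuous with `‖F‖ ≤ M`, `‖F y - F z‖ ≤ A ‖y - z‖^β`
(`0 ≤ β ≤ 1`), there is `K₂ = K₂(n, β)` with
`‖∂ⱼe^{aΔ}∂ₗe^{aΔ}(m F)(x) - m(x) ∂ⱼe^{aΔ}∂ₗe^{aΔ}F(x)‖ ≤ K₂ a^{(β-1)/2} (L A + L' M) ‖vⱼ‖ ‖vₗ‖`:
`[PⱼPₗ, m] = Pⱼ[Pₗ, m] + [Pⱼ, m]Pₗ`, `[Pₗ, m]F = (Pₗm) • F + O(a^{β/2})` with `(Pₗm) • F` `β`-Hölder.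
[folklore] -/
theorem exists_norm_heatCommutator₂_le {β : ℝ} (hβ0 : 0 ≤ β) (hβ1 : β ≤ 1) :
    ∃ K : ℝ, 0 ≤ K ∧ ∀ {m : E → ℝ} (_ : ContDiff ℝ 1 m) {Cm : ℝ} (_ : ∀ z, ‖m z‖ ≤ Cm)
      {L : ℝ} (_ : ∀ z, ‖fderiv ℝ m z‖ ≤ L) {L' : ℝ} (_ : 0 ≤ L')
      (_ : ∀ y z, ‖fderiv ℝ m y - fderiv ℝ m z‖ ≤ L' * ‖y - z‖ ^ β)
      {G : E → F} (_ : Continuous G) {M : ℝ} (_ : ∀ z, ‖G z‖ ≤ M) {A : ℝ} (_ : 0 ≤ A)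
      (_ : ∀ y z, ‖G y - G z‖ ≤ A * ‖y - z‖ ^ β) {a : ℝ} (_ : 0 < a) (x vj vl : E),
      ‖fderiv ℝ (heatExtension (fun y => fderiv ℝ (heatExtension (fun z => m z • G z) a) y vl) a) x vj -
          m x • fderiv ℝ (heatExtension (fun y => fderiv ℝ (heatExtension G a) y vl) a) x vj‖ ≤
        K * a ^ ((β - 1) / 2) * (L * A + L' * M) * ‖vj‖ * ‖vl‖ := by
  set c : ℝ := (2 : ℝ) ^ ((Module.finrank ℝ E : ℝ) / 2) with hc
  set c₁ : ℝ := 2 * c * (1 + 2 * c) with hc₁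
  set κ₁ : ℝ := (2 : ℝ) ^ (1 / 2 : ℝ) * c * (1 + 2 * c) with hκ₁
  set κ₂ : ℝ := 2 * (2 : ℝ) ^ (1 / 2 : ℝ) * c ^ 2 * (1 + 2 * c) with hκ₂
  have hc0 : 0 < c := Real.rpow_pos_of_pos two_pos _
  have hc₁0 : 0 ≤ c₁ := by positivity
  have hκ₁0 : 0 ≤ κ₁ := by positivity
  have hκ₂0 : 0 ≤ κ₂ := by positivity
  refine ⟨c₁ + c * (2 * κ₂) + κ₁ * c₁, by positivity, ?_⟩
  intro m hm Cm hCm L hL L' hL'0 hL' G hG M hM A hA hH a ha x vj vl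
  have hL0 : 0 ≤ L := (norm_nonneg _).trans (hL 0)
  have hM0 : 0 ≤ M := (norm_nonneg _).trans (hM 0)
  have hLip : ∀ y z, ‖m y - m z‖ ≤ L * ‖y - z‖ := norm_sub_le_of_norm_fderiv_le hm hL
  have hmc : Continuous m := hm.continuous
  -- the pieces
  set mG : E → F := fun z => m z • G z with hmG
  have hmGc : Continuous mG := hmc.smul hG
  have hmGb : ∀ z, ‖mG z‖ ≤ Cm * M := fun z => by
    rw [hmG]; dsimp only; rw [norm_smul]
    exact mul_le_mul (hCm z) (hM z) (norm_nonneg _) ((norm_nonneg _).trans (hCm z))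
  set F₁ : E → F := fun y => fderiv ℝ (heatExtension G a) y vl with hF₁
  have hF₁c : Continuous F₁ := continuous_fderiv_heatExtension_apply_of_bound hG hM ha vl
  have hF₁b : ∀ y, ‖F₁ y‖ ≤ c₁ * a ^ ((β - 1) / 2) * A * ‖vl‖ := fun y =>
    norm_fderiv_heatExtension_apply_le_of_holder' hG hM hA hβ0 hβ1 hH ha y vl
  set G₁ : E → F := fun y => fderiv ℝ (heatExtension mG a) y vl with hG₁
  have hG₁c : Continuous G₁ := continuous_fderiv_heatExtension_apply_of_bound hmGc hmGb ha vl
  -- the scalar `Pₗ m` and the explicit part `ψ = (Pₗ m) • G`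
  set φ : E → ℝ := fun y => fderiv ℝ (heatExtension m a) y vl with hφ
  have hφc : Continuous φ := continuous_fderiv_heatExtension_apply_of_bound hmc hCm ha vl
  have hφb : ∀ y, ‖φ y‖ ≤ L * ‖vl‖ := fun y => norm_fderiv_heatExtension_apply_le_of_fderiv_le hm hCm hL ha y vl
  have hφH : ∀ y z, ‖φ y - φ z‖ ≤ L' * ‖vl‖ * ‖y - z‖ ^ β := fun y z =>
    norm_fderiv_heatExtension_apply_sub_le_of_fderiv_holder hm hCm hL hL' ha vl y z
  set ψ : E → F := fun y => φ y • G y with hψ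
  have hψc : Continuous ψ := hφc.smul hG
  have hψb : ∀ y, ‖ψ y‖ ≤ L * ‖vl‖ * M := fun y => by
    rw [hψ]; dsimp only; rw [norm_smul]
    exact mul_le_mul (hφb y) (hM y) (norm_nonneg _) (by positivity)
  have hψH : ∀ y z, ‖ψ y - ψ z‖ ≤ (L * A + L' * M) * ‖vl‖ * ‖y - z‖ ^ β := fun y z => by
    have hyz : 0 ≤ ‖y - z‖ ^ β := Real.rpow_nonneg (norm_nonneg _) _
    calc ‖ψ y - ψ z‖ = ‖(φ y - φ z) • G y + φ z • (G y - G z)‖ := by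
          rw [hψ]; dsimp only; rw [sub_smul, smul_sub]; abel_nf
      _ ≤ ‖φ y - φ z‖ * ‖G y‖ + ‖φ z‖ * ‖G y - G z‖ := by
          refine (norm_add_le _ _).trans (add_le_add ?_ ?_) <;> rw [norm_smul]
      _ ≤ (L' * ‖vl‖ * ‖y - z‖ ^ β) * M + (L * ‖vl‖) * (A * ‖y - z‖ ^ β) := by
          gcongr
          · exact hφH y z
          · exact hM y
          · exact hφb z
          · exact hH y z
      _ = (L * A + L' * M) * ‖vl‖ * ‖y - z‖ ^ β := by ring
  -- the remainder `R = [Pₗ, m]G - ψ`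
  set R : E → F := fun y => G₁ y - m y • F₁ y - ψ y with hR
  have hRc : Continuous R := (hG₁c.sub (hmc.smul hF₁c)).sub hψc
  have hRb : ∀ y, ‖R y‖ ≤ κ₂ * (4 * a) ^ (β / 2) * L * A * ‖vl‖ := fun y =>
    norm_heatCommutator_sub_smul_le hmc hCm hL0 hLip hG hM hA hβ0 hβ1 hH ha y vl
  have h4a : (4 * a) ^ (β / 2) ≤ 2 * a ^ (β / 2) := by
    rw [Real.mul_rpow (by norm_num : (0 : ℝ) ≤ 4) ha.le]
    refine mul_le_mul_of_nonneg_right ?_ (Real.rpow_nonneg ha.le _)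
    calc (4 : ℝ) ^ (β / 2) ≤ (4 : ℝ) ^ (1 / 2 : ℝ) :=
          Real.rpow_le_rpow_of_exponent_le (by norm_num) (by linarith)
      _ = 2 := by
          rw [show (4 : ℝ) = 2 ^ (2 : ℝ) by norm_num, ← Real.rpow_mul (by norm_num)]; norm_num
  have hRb' : ∀ y, ‖R y‖ ≤ 2 * κ₂ * a ^ (β / 2) * L * A * ‖vl‖ := fun y =>
    (hRb y).trans (by
      have : κ₂ * (4 * a) ^ (β / 2) ≤ κ₂ * (2 * a ^ (β / 2)) := mul_le_mul_of_nonneg_left h4a hκ₂0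
      calc κ₂ * (4 * a) ^ (β / 2) * L * A * ‖vl‖ ≤ κ₂ * (2 * a ^ (β / 2)) * L * A * ‖vl‖ := by gcongr
        _ = 2 * κ₂ * a ^ (β / 2) * L * A * ‖vl‖ := by ring)
  -- `G₁ = m • F₁ + (ψ + R)` and linearity
  have hG₁eq : G₁ = fun y => m y • F₁ y + (ψ y + R y) := by
    funext y; rw [hR]; dsimp only; abel
  have hmF₁c : Continuous fun y => m y • F₁ y := hmc.smul hF₁c
  have hmF₁b : ∀ y, ‖m y • F₁ y‖ ≤ Cm * (c₁ * a ^ ((β - 1) / 2) * A * ‖vl‖) := fun y => by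
    rw [norm_smul]
    exact mul_le_mul (hCm y) (hF₁b y) (norm_nonneg _) ((norm_nonneg _).trans (hCm y))
  have hψRb : ∀ y, ‖ψ y + R y‖ ≤ L * ‖vl‖ * M + 2 * κ₂ * a ^ (β / 2) * L * A * ‖vl‖ := fun y =>
    (norm_add_le _ _).trans (add_le_add (hψb y) (hRb' y))
  have hsplit : fderiv ℝ (heatExtension G₁ a) x vj =
      fderiv ℝ (heatExtension (fun y => m y • F₁ y) a) x vj +
        (fderiv ℝ (heatExtension ψ a) x vj + fderiv ℝ (heatExtension R a) x vj) := by
    have hψRc : Continuous fun y => ψ y + R y := hψc.add hRc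
    rw [hG₁eq, fderiv_heatExtension_add_apply_of_bound hmF₁c hψRc hmF₁b hψRb ha x vj,
      fderiv_heatExtension_add_apply_of_bound hψc hRc hψb hRb' ha x vj]
  -- the three bounds
  have h1 : ‖fderiv ℝ (heatExtension (fun y => m y • F₁ y) a) x vj - m x • fderiv ℝ (heatExtension F₁ a) x vj‖ ≤
      κ₁ * L * (c₁ * a ^ ((β - 1) / 2) * A * ‖vl‖) * ‖vj‖ :=
    norm_heatCommutator_le hmc hCm hL0 hLip hF₁c hF₁b ha x vj
  have h2 : ‖fderiv ℝ (heatExtension ψ a) x vj‖ ≤ c₁ * a ^ ((β - 1) / 2) * ((L * A + L' * M) * ‖vl‖) * ‖vj‖ :=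
    norm_fderiv_heatExtension_apply_le_of_holder' hψc hψb (by positivity) hβ0 hβ1 hψH ha x vj
  have h3 : ‖fderiv ℝ (heatExtension R a) x vj‖ ≤
      c * a ^ (-(1 / 2 : ℝ)) * (2 * κ₂ * a ^ (β / 2) * L * A * ‖vl‖) * ‖vj‖ :=
    norm_fderiv_heatExtension_apply_le_of_continuous hRc hRb' ha x vj
  have hpow : a ^ (-(1 / 2 : ℝ)) * a ^ (β / 2) = a ^ ((β - 1) / 2) := by
    rw [rpow_neg_half_mul_rpow ha]; congr 1; ring
  have h3' : ‖fderiv ℝ (heatExtension R a) x vj‖ ≤ c * (2 * κ₂) * a ^ ((β - 1) / 2) * L * A * ‖vj‖ * ‖vl‖ := by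
    refine h3.trans_eq ?_
    calc c * a ^ (-(1 / 2 : ℝ)) * (2 * κ₂ * a ^ (β / 2) * L * A * ‖vl‖) * ‖vj‖
        = c * (2 * κ₂) * (a ^ (-(1 / 2 : ℝ)) * a ^ (β / 2)) * L * A * ‖vj‖ * ‖vl‖ := by ring
      _ = _ := by rw [hpow]
  -- assemble
  have hLA : L * A ≤ L * A + L' * M := le_add_of_nonneg_right (mul_nonneg hL'0 hM0)
  have hpos : 0 ≤ a ^ ((β - 1) / 2) := Real.rpow_nonneg ha.le _
  calc ‖fderiv ℝ (heatExtension G₁ a) x vj - m x • fderiv ℝ (heatExtension F₁ a) x vj‖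
      = ‖(fderiv ℝ (heatExtension (fun y => m y • F₁ y) a) x vj - m x • fderiv ℝ (heatExtension F₁ a) x vj) +
          fderiv ℝ (heatExtension ψ a) x vj + fderiv ℝ (heatExtension R a) x vj‖ := by
        rw [hsplit]; congr 1; abel
    _ ≤ ‖fderiv ℝ (heatExtension (fun y => m y • F₁ y) a) x vj - m x • fderiv ℝ (heatExtension F₁ a) x vj‖ +
          ‖fderiv ℝ (heatExtension ψ a) x vj‖ + ‖fderiv ℝ (heatExtension R a) x vj‖ := norm_add₃_le
    _ ≤ κ₁ * L * (c₁ * a ^ ((β - 1) / 2) * A * ‖vl‖) * ‖vj‖ +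
          c₁ * a ^ ((β - 1) / 2) * ((L * A + L' * M) * ‖vl‖) * ‖vj‖ +
          c * (2 * κ₂) * a ^ ((β - 1) / 2) * L * A * ‖vj‖ * ‖vl‖ := add_le_add_three h1 h2 h3'
    _ = (κ₁ * c₁ * (L * A) + c₁ * (L * A + L' * M) + c * (2 * κ₂) * (L * A)) *
          a ^ ((β - 1) / 2) * ‖vj‖ * ‖vl‖ := by ring
    _ ≤ (κ₁ * c₁ * (L * A + L' * M) + c₁ * (L * A + L' * M) + c * (2 * κ₂) * (L * A + L' * M)) *
          a ^ ((β - 1) / 2) * ‖vj‖ * ‖vl‖ := by gcongr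
    _ = (c₁ + c * (2 * κ₂) + κ₁ * c₁) * a ^ ((β - 1) / 2) * (L * A + L' * M) * ‖vj‖ * ‖vl‖ := by ring

/-- **The third-order commutator** `[∂ᵢe^{aΔ}∂ⱼe^{aΔ}∂ₗe^{aΔ}, m] F`: with the data of
`exists_norm_heatCommutator₂_le` there is `K₃ = K₃(n, β)` with
`‖∂ᵢe^{aΔ}∂ⱼe^{aΔ}∂ₗe^{aΔ}(m F)(x) - m(x) ∂ᵢe^{aΔ}∂ⱼe^{aΔ}∂ₗe^{aΔ}F(x)‖ ≤ K₃ a^{β/2-1} (L A + L' M) ‖vᵢ‖ ‖vⱼ‖ ‖vₗ‖`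
(`[PᵢX, m] = Pᵢ[X, m] + [Pᵢ, m]X` with `X = PⱼPₗ`). With `3a = σ` this is the bound
`‖[∂ᵢ∂ⱼ∂ₗe^{σΔ}, m]F‖_∞ ≲ σ^{β/2-1}(‖∇m‖_∞[F]_β + [∇m]_β‖F‖_∞)`, integrable at `σ = 0`.
[folklore] -/
theorem exists_norm_heatCommutator₃_le {β : ℝ} (hβ0 : 0 ≤ β) (hβ1 : β ≤ 1) :
    ∃ K : ℝ, 0 ≤ K ∧ ∀ {m : E → ℝ} (_ : ContDiff ℝ 1 m) {Cm : ℝ} (_ : ∀ z, ‖m z‖ ≤ Cm)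
      {L : ℝ} (_ : ∀ z, ‖fderiv ℝ m z‖ ≤ L) {L' : ℝ} (_ : 0 ≤ L')
      (_ : ∀ y z, ‖fderiv ℝ m y - fderiv ℝ m z‖ ≤ L' * ‖y - z‖ ^ β)
      {G : E → F} (_ : Continuous G) {M : ℝ} (_ : ∀ z, ‖G z‖ ≤ M) {A : ℝ} (_ : 0 ≤ A)
      (_ : ∀ y z, ‖G y - G z‖ ≤ A * ‖y - z‖ ^ β) {a : ℝ} (_ : 0 < a) (x vi vj vl : E),
      ‖fderiv ℝ (heatExtension (fun y' => fderiv ℝ (heatExtension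
            (fun y => fderiv ℝ (heatExtension (fun z => m z • G z) a) y vl) a) y' vj) a) x vi -
          m x • fderiv ℝ (heatExtension (fun y' => fderiv ℝ (heatExtension
            (fun y => fderiv ℝ (heatExtension G a) y vl) a) y' vj) a) x vi‖ ≤
        K * a ^ (β / 2 - 1) * (L * A + L' * M) * ‖vi‖ * ‖vj‖ * ‖vl‖ := by
  set c : ℝ := (2 : ℝ) ^ ((Module.finrank ℝ E : ℝ) / 2) with hc
  set c₁ : ℝ := 2 * c * (1 + 2 * c) with hc₁
  set κ₁ : ℝ := (2 : ℝ) ^ (1 / 2 : ℝ) * c * (1 + 2 * c) with hκ₁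
  have hc0 : 0 < c := Real.rpow_pos_of_pos two_pos _
  have hc₁0 : 0 ≤ c₁ := by positivity
  have hκ₁0 : 0 ≤ κ₁ := by positivity
  obtain ⟨K₂, hK₂0, hK₂⟩ := exists_norm_heatCommutator₂_le (E := E) (F := F) hβ0 hβ1
  refine ⟨c * K₂ + κ₁ * (c * c₁), by positivity, ?_⟩
  intro m hm Cm hCm L hL L' hL'0 hL' G hG M hM A hA hH a ha x vi vj vl
  have hL0 : 0 ≤ L := (norm_nonneg _).trans (hL 0)
  have hM0 : 0 ≤ M := (norm_nonneg _).trans (hM 0)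
  have hLip : ∀ y z, ‖m y - m z‖ ≤ L * ‖y - z‖ := norm_sub_le_of_norm_fderiv_le hm hL
  have hmc : Continuous m := hm.continuous
  set mG : E → F := fun z => m z • G z with hmG
  have hmGc : Continuous mG := hmc.smul hG
  have hmGb : ∀ z, ‖mG z‖ ≤ Cm * M := fun z => by
    rw [hmG]; dsimp only; rw [norm_smul]
    exact mul_le_mul (hCm z) (hM z) (norm_nonneg _) ((norm_nonneg _).trans (hCm z))
  -- `Z = PⱼPₗG`, `Y = PⱼPₗ(mG)`, `Q = Y - m • Z`
  set F₁ : E → F := fun y => fderiv ℝ (heatExtension G a) y vl with hF₁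
  have hF₁c : Continuous F₁ := continuous_fderiv_heatExtension_apply_of_bound hG hM ha vl
  have hF₁b : ∀ y, ‖F₁ y‖ ≤ c₁ * a ^ ((β - 1) / 2) * A * ‖vl‖ := fun y =>
    norm_fderiv_heatExtension_apply_le_of_holder' hG hM hA hβ0 hβ1 hH ha y vl
  set Z : E → F := fun y' => fderiv ℝ (heatExtension F₁ a) y' vj with hZ
  have hZc : Continuous Z := continuous_fderiv_heatExtension_apply_of_bound hF₁c hF₁b ha vj
  have hZb : ∀ y, ‖Z y‖ ≤ c * c₁ * a ^ (β / 2 - 1) * A * ‖vj‖ * ‖vl‖ := fun y =>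
    norm_fderiv_heatExtension₂_apply_le_of_holder hG hM hA hβ0 hβ1 hH ha y vj vl
  set G₁ : E → F := fun y => fderiv ℝ (heatExtension mG a) y vl with hG₁
  have hG₁c : Continuous G₁ := continuous_fderiv_heatExtension_apply_of_bound hmGc hmGb ha vl
  have hG₁b : ∀ y, ‖G₁ y‖ ≤ c * a ^ (-(1 / 2 : ℝ)) * (Cm * M) * ‖vl‖ := fun y =>
    norm_fderiv_heatExtension_apply_le_of_continuous hmGc hmGb ha y vl
  set Y : E → F := fun y' => fderiv ℝ (heatExtension G₁ a) y' vj with hY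
  have hYc : Continuous Y := continuous_fderiv_heatExtension_apply_of_bound hG₁c hG₁b ha vj
  set Q : E → F := fun y => Y y - m y • Z y with hQ
  have hQc : Continuous Q := hYc.sub (hmc.smul hZc)
  have hQb : ∀ y, ‖Q y‖ ≤ K₂ * a ^ ((β - 1) / 2) * (L * A + L' * M) * ‖vj‖ * ‖vl‖ := fun y =>
    hK₂ hm hCm hL hL'0 hL' hG hM hA hH ha y vj vl
  have hmZc : Continuous fun y => m y • Z y := hmc.smul hZc
  have hmZb : ∀ y, ‖m y • Z y‖ ≤ Cm * (c * c₁ * a ^ (β / 2 - 1) * A * ‖vj‖ * ‖vl‖) := fun y => by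
    rw [norm_smul]
    exact mul_le_mul (hCm y) (hZb y) (norm_nonneg _) ((norm_nonneg _).trans (hCm y))
  have hYeq : Y = fun y => Q y + m y • Z y := by funext y; rw [hQ]; dsimp only; abel
  have hsplit : fderiv ℝ (heatExtension Y a) x vi =
      fderiv ℝ (heatExtension Q a) x vi + fderiv ℝ (heatExtension (fun y => m y • Z y) a) x vi := by
    rw [hYeq, fderiv_heatExtension_add_apply_of_bound hQc hmZc hQb hmZb ha x vi]
  have h1 : ‖fderiv ℝ (heatExtension Q a) x vi‖ ≤
      c * a ^ (-(1 / 2 : ℝ)) * (K₂ * a ^ ((β - 1) / 2) * (L * A + L' * M) * ‖vj‖ * ‖vl‖) * ‖vi‖ :=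
    norm_fderiv_heatExtension_apply_le_of_continuous hQc hQb ha x vi
  have h2 : ‖fderiv ℝ (heatExtension (fun y => m y • Z y) a) x vi - m x • fderiv ℝ (heatExtension Z a) x vi‖ ≤
      κ₁ * L * (c * c₁ * a ^ (β / 2 - 1) * A * ‖vj‖ * ‖vl‖) * ‖vi‖ :=
    norm_heatCommutator_le hmc hCm hL0 hLip hZc hZb ha x vi
  have hpow : a ^ (-(1 / 2 : ℝ)) * a ^ ((β - 1) / 2) = a ^ (β / 2 - 1) := by
    rw [rpow_neg_half_mul_rpow ha]; congr 1; ring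
  have hLA : L * A ≤ L * A + L' * M := le_add_of_nonneg_right (mul_nonneg hL'0 hM0)
  have hpos : 0 ≤ a ^ (β / 2 - 1) := Real.rpow_nonneg ha.le _
  calc ‖fderiv ℝ (heatExtension Y a) x vi - m x • fderiv ℝ (heatExtension Z a) x vi‖
      = ‖fderiv ℝ (heatExtension Q a) x vi +
          (fderiv ℝ (heatExtension (fun y => m y • Z y) a) x vi - m x • fderiv ℝ (heatExtension Z a) x vi)‖ := by
        rw [hsplit]; congr 1; abel
    _ ≤ ‖fderiv ℝ (heatExtension Q a) x vi‖ +
          ‖fderiv ℝ (heatExtension (fun y => m y • Z y) a) x vi - m x • fderiv ℝ (heatExtension Z a) x vi‖ :=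
        norm_add_le _ _
    _ ≤ c * a ^ (-(1 / 2 : ℝ)) * (K₂ * a ^ ((β - 1) / 2) * (L * A + L' * M) * ‖vj‖ * ‖vl‖) * ‖vi‖ +
          κ₁ * L * (c * c₁ * a ^ (β / 2 - 1) * A * ‖vj‖ * ‖vl‖) * ‖vi‖ := add_le_add h1 h2
    _ = c * K₂ * (a ^ (-(1 / 2 : ℝ)) * a ^ ((β - 1) / 2)) * (L * A + L' * M) * ‖vi‖ * ‖vj‖ * ‖vl‖ +
          κ₁ * (c * c₁) * a ^ (β / 2 - 1) * (L * A) * ‖vi‖ * ‖vj‖ * ‖vl‖ := by ring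
    _ ≤ c * K₂ * a ^ (β / 2 - 1) * (L * A + L' * M) * ‖vi‖ * ‖vj‖ * ‖vl‖ +
          κ₁ * (c * c₁) * a ^ (β / 2 - 1) * (L * A + L' * M) * ‖vi‖ * ‖vj‖ * ‖vl‖ := by
        rw [hpow]; gcongr
    _ = (c * K₂ + κ₁ * (c * c₁)) * a ^ (β / 2 - 1) * (L * A + L' * M) * ‖vi‖ * ‖vj‖ * ‖vl‖ := by ring

/-- **The fourth-order commutator** `[∂ᵤe^{aΔ}∂ᵢe^{aΔ}∂ⱼe^{aΔ}∂ₗe^{aΔ}, m] F`: with the data of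
`exists_norm_heatCommutator₂_le` there is `K₄ = K₄(n, β)` with the bound
`K₄ a^{(β-3)/2} (L A + L' M) ‖vᵤ‖ ‖vᵢ‖ ‖vⱼ‖ ‖vₗ‖`. With `4a = σ` this is
`‖∇[∂ᵢ∂ⱼ∂ₗe^{σΔ}, m]F‖_∞`-type control `≲ σ^{(β-3)/2}`, the Lipschitz input of the near-field
Hölder estimate (Lunardi 1995, §3.1). [folklore] -/
theorem exists_norm_heatCommutator₄_le {β : ℝ} (hβ0 : 0 ≤ β) (hβ1 : β ≤ 1) :
    ∃ K : ℝ, 0 ≤ K ∧ ∀ {m : E → ℝ} (_ : ContDiff ℝ 1 m) {Cm : ℝ} (_ : ∀ z, ‖m z‖ ≤ Cm)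
      {L : ℝ} (_ : ∀ z, ‖fderiv ℝ m z‖ ≤ L) {L' : ℝ} (_ : 0 ≤ L')
      (_ : ∀ y z, ‖fderiv ℝ m y - fderiv ℝ m z‖ ≤ L' * ‖y - z‖ ^ β)
      {G : E → F} (_ : Continuous G) {M : ℝ} (_ : ∀ z, ‖G z‖ ≤ M) {A : ℝ} (_ : 0 ≤ A)
      (_ : ∀ y z, ‖G y - G z‖ ≤ A * ‖y - z‖ ^ β) {a : ℝ} (_ : 0 < a) (x vu vi vj vl : E),
      ‖fderiv ℝ (heatExtension (fun y'' => fderiv ℝ (heatExtension (fun y' => fderiv ℝ (heatExtension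
            (fun y => fderiv ℝ (heatExtension (fun z => m z • G z) a) y vl) a) y' vj) a) y'' vi) a) x vu -
          m x • fderiv ℝ (heatExtension (fun y'' => fderiv ℝ (heatExtension (fun y' => fderiv ℝ (heatExtension
            (fun y => fderiv ℝ (heatExtension G a) y vl) a) y' vj) a) y'' vi) a) x vu‖ ≤
        K * a ^ ((β - 3) / 2) * (L * A + L' * M) * ‖vu‖ * ‖vi‖ * ‖vj‖ * ‖vl‖ := by
  set c : ℝ := (2 : ℝ) ^ ((Module.finrank ℝ E : ℝ) / 2) with hc
  set c₁ : ℝ := 2 * c * (1 + 2 * c) with hc₁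
  set κ₁ : ℝ := (2 : ℝ) ^ (1 / 2 : ℝ) * c * (1 + 2 * c) with hκ₁
  have hc0 : 0 < c := Real.rpow_pos_of_pos two_pos _
  have hc₁0 : 0 ≤ c₁ := by positivity
  have hκ₁0 : 0 ≤ κ₁ := by positivity
  obtain ⟨K₃, hK₃0, hK₃⟩ := exists_norm_heatCommutator₃_le (E := E) (F := F) hβ0 hβ1
  refine ⟨c * K₃ + κ₁ * (c ^ 2 * c₁), by positivity, ?_⟩
  intro m hm Cm hCm L hL L' hL'0 hL' G hG M hM A hA hH a ha x vu vi vj vl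
  have hL0 : 0 ≤ L := (norm_nonneg _).trans (hL 0)
  have hM0 : 0 ≤ M := (norm_nonneg _).trans (hM 0)
  have hLip : ∀ y z, ‖m y - m z‖ ≤ L * ‖y - z‖ := norm_sub_le_of_norm_fderiv_le hm hL
  have hmc : Continuous m := hm.continuous
  set mG : E → F := fun z => m z • G z with hmG
  have hmGc : Continuous mG := hmc.smul hG
  have hmGb : ∀ z, ‖mG z‖ ≤ Cm * M := fun z => by
    rw [hmG]; dsimp only; rw [norm_smul]
    exact mul_le_mul (hCm z) (hM z) (norm_nonneg _) ((norm_nonneg _).trans (hCm z))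
  -- `Z = PᵢPⱼPₗG`, `Y = PᵢPⱼPₗ(mG)`, `Q = Y - m • Z`
  set F₁ : E → F := fun y => fderiv ℝ (heatExtension G a) y vl with hF₁
  have hF₁c : Continuous F₁ := continuous_fderiv_heatExtension_apply_of_bound hG hM ha vl
  have hF₁b : ∀ y, ‖F₁ y‖ ≤ c₁ * a ^ ((β - 1) / 2) * A * ‖vl‖ := fun y =>
    norm_fderiv_heatExtension_apply_le_of_holder' hG hM hA hβ0 hβ1 hH ha y vl
  set F₂ : E → F := fun y' => fderiv ℝ (heatExtension F₁ a) y' vj with hF₂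
  have hF₂c : Continuous F₂ := continuous_fderiv_heatExtension_apply_of_bound hF₁c hF₁b ha vj
  have hF₂b : ∀ y, ‖F₂ y‖ ≤ c * c₁ * a ^ (β / 2 - 1) * A * ‖vj‖ * ‖vl‖ := fun y =>
    norm_fderiv_heatExtension₂_apply_le_of_holder hG hM hA hβ0 hβ1 hH ha y vj vl
  set Z : E → F := fun y'' => fderiv ℝ (heatExtension F₂ a) y'' vi with hZ
  have hZc : Continuous Z := continuous_fderiv_heatExtension_apply_of_bound hF₂c hF₂b ha vi
  have hZb : ∀ y, ‖Z y‖ ≤ c ^ 2 * c₁ * a ^ ((β - 3) / 2) * A * ‖vi‖ * ‖vj‖ * ‖vl‖ := fun y =>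
    norm_fderiv_heatExtension₃_apply_le_of_holder hG hM hA hβ0 hβ1 hH ha y vi vj vl
  set G₁ : E → F := fun y => fderiv ℝ (heatExtension mG a) y vl with hG₁
  have hG₁c : Continuous G₁ := continuous_fderiv_heatExtension_apply_of_bound hmGc hmGb ha vl
  have hG₁b : ∀ y, ‖G₁ y‖ ≤ c * a ^ (-(1 / 2 : ℝ)) * (Cm * M) * ‖vl‖ := fun y =>
    norm_fderiv_heatExtension_apply_le_of_continuous hmGc hmGb ha y vl
  set G₂ : E → F := fun y' => fderiv ℝ (heatExtension G₁ a) y' vj with hG₂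
  have hG₂c : Continuous G₂ := continuous_fderiv_heatExtension_apply_of_bound hG₁c hG₁b ha vj
  have hG₂b : ∀ y, ‖G₂ y‖ ≤ c * a ^ (-(1 / 2 : ℝ)) * (c * a ^ (-(1 / 2 : ℝ)) * (Cm * M) * ‖vl‖) * ‖vj‖ :=
    fun y => norm_fderiv_heatExtension_apply_le_of_continuous hG₁c hG₁b ha y vj
  set Y : E → F := fun y'' => fderiv ℝ (heatExtension G₂ a) y'' vi with hY
  have hYc : Continuous Y := continuous_fderiv_heatExtension_apply_of_bound hG₂c hG₂b ha vi
  set Q : E → F := fun y => Y y - m y • Z y with hQ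
  have hQc : Continuous Q := hYc.sub (hmc.smul hZc)
  have hQb : ∀ y, ‖Q y‖ ≤ K₃ * a ^ (β / 2 - 1) * (L * A + L' * M) * ‖vi‖ * ‖vj‖ * ‖vl‖ := fun y =>
    hK₃ hm hCm hL hL'0 hL' hG hM hA hH ha y vi vj vl
  have hmZc : Continuous fun y => m y • Z y := hmc.smul hZc
  have hmZb : ∀ y, ‖m y • Z y‖ ≤ Cm * (c ^ 2 * c₁ * a ^ ((β - 3) / 2) * A * ‖vi‖ * ‖vj‖ * ‖vl‖) :=
    fun y => by
    rw [norm_smul]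
    exact mul_le_mul (hCm y) (hZb y) (norm_nonneg _) ((norm_nonneg _).trans (hCm y))
  have hYeq : Y = fun y => Q y + m y • Z y := by funext y; rw [hQ]; dsimp only; abel
  have hsplit : fderiv ℝ (heatExtension Y a) x vu =
      fderiv ℝ (heatExtension Q a) x vu + fderiv ℝ (heatExtension (fun y => m y • Z y) a) x vu := by
    rw [hYeq, fderiv_heatExtension_add_apply_of_bound hQc hmZc hQb hmZb ha x vu]
  have h1 : ‖fderiv ℝ (heatExtension Q a) x vu‖ ≤
      c * a ^ (-(1 / 2 : ℝ)) * (K₃ * a ^ (β / 2 - 1) * (L * A + L' * M) * ‖vi‖ * ‖vj‖ * ‖vl‖) * ‖vu‖ :=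
    norm_fderiv_heatExtension_apply_le_of_continuous hQc hQb ha x vu
  have h2 : ‖fderiv ℝ (heatExtension (fun y => m y • Z y) a) x vu - m x • fderiv ℝ (heatExtension Z a) x vu‖ ≤
      κ₁ * L * (c ^ 2 * c₁ * a ^ ((β - 3) / 2) * A * ‖vi‖ * ‖vj‖ * ‖vl‖) * ‖vu‖ :=
    norm_heatCommutator_le hmc hCm hL0 hLip hZc hZb ha x vu
  have hpow : a ^ (-(1 / 2 : ℝ)) * a ^ (β / 2 - 1) = a ^ ((β - 3) / 2) := by
    rw [rpow_neg_half_mul_rpow ha]; congr 1; ring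
  have hLA : L * A ≤ L * A + L' * M := le_add_of_nonneg_right (mul_nonneg hL'0 hM0)
  have hpos : 0 ≤ a ^ ((β - 3) / 2) := Real.rpow_nonneg ha.le _
  calc ‖fderiv ℝ (heatExtension Y a) x vu - m x • fderiv ℝ (heatExtension Z a) x vu‖
      = ‖fderiv ℝ (heatExtension Q a) x vu +
          (fderiv ℝ (heatExtension (fun y => m y • Z y) a) x vu - m x • fderiv ℝ (heatExtension Z a) x vu)‖ := by
        rw [hsplit]; congr 1; abel
    _ ≤ ‖fderiv ℝ (heatExtension Q a) x vu‖ +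
          ‖fderiv ℝ (heatExtension (fun y => m y • Z y) a) x vu - m x • fderiv ℝ (heatExtension Z a) x vu‖ :=
        norm_add_le _ _
    _ ≤ c * a ^ (-(1 / 2 : ℝ)) * (K₃ * a ^ (β / 2 - 1) * (L * A + L' * M) * ‖vi‖ * ‖vj‖ * ‖vl‖) * ‖vu‖ +
          κ₁ * L * (c ^ 2 * c₁ * a ^ ((β - 3) / 2) * A * ‖vi‖ * ‖vj‖ * ‖vl‖) * ‖vu‖ := add_le_add h1 h2
    _ = c * K₃ * (a ^ (-(1 / 2 : ℝ)) * a ^ (β / 2 - 1)) * (L * A + L' * M) * ‖vu‖ * ‖vi‖ * ‖vj‖ * ‖vl‖ +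
          κ₁ * (c ^ 2 * c₁) * a ^ ((β - 3) / 2) * (L * A) * ‖vu‖ * ‖vi‖ * ‖vj‖ * ‖vl‖ := by ring
    _ ≤ c * K₃ * a ^ ((β - 3) / 2) * (L * A + L' * M) * ‖vu‖ * ‖vi‖ * ‖vj‖ * ‖vl‖ +
          κ₁ * (c ^ 2 * c₁) * a ^ ((β - 3) / 2) * (L * A + L' * M) * ‖vu‖ * ‖vi‖ * ‖vj‖ * ‖vl‖ := by
        rw [hpow]; gcongr
    _ = (c * K₃ + κ₁ * (c ^ 2 * c₁)) * a ^ ((β - 3) / 2) * (L * A + L' * M) *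
          ‖vu‖ * ‖vi‖ * ‖vj‖ * ‖vl‖ := by ring

end Operator

end Literature.Analysis.UnboundedOperators
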